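import Summits.ResolutionOfSingularities.ResolutionOfSingularities.Theorems.FrobeniusLadderFInjectiveMacaulayficationFHalfRowOfTwoStoreysCompose
import HarnessLib

/-!
# (W-TD) two-storey glue, PUSH-FORWARD form (W1′): the storey-2 centre given on ONE CHART `ι : U ↪ X₁` as an ideal sheaf `K′` and extended to `X₁` as `J′ := K′.map ι`
# (crux `FInjectiveMacaulayfication` stmt-ResolutionOfSingularities-15315, chain w45a; res-L1-w45a-plan-1 RULING R21.26 «(W1′) ADOPTED as the kernel form of the storey-2
# centre: J := (K′~).map ι₂₇₇ (largest extension; Supp J = closure by `support_map`; J|U = K′ by `ideal_map`)» and R21.27 (2)(a); seat res-L1-w45a-stub-1 g13; GENERIC part,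
# filed ahead of BED D's data modules (storey-1 res-L1-w45a-stub-2, Σ_G / boundary res-L1-w45a-stub-3))

[OURS · L1 W4.5a] Support file (`--supports stmt-ResolutionOfSingularities-15315 --as helper`); def-free; UNCONDITIONAL; no named fact; NOT a statement of any manuscript.
Nothing of the crux is proved. AI-written (AI review is weaker than expert review).

* §1 `comap_map_of_isOpenImmersion` — for an open immersion `ι : U → Y` (quasi-compact) and an ideal sheaf `K` on `U`: `(K.map ι)|_U = K`, i.e. `(K.map ι).comap ι = K`
  (Mathlib's `ideal_map` / `ideal_comap_of_isOpenImmersion` on each affine open); `map_ne_bot_of_isOpenImmersion`.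
* §2 `specializes_of_mem_support_map` / `support_map_generization` — `Supp (K.map ι) = closure ι(Supp K)` lies over the closure of `x` as soon as `ι(Supp K)` does; hence
  it meets the generizations of `x` only in `x` (the `hsupp'` input of the two-storey glue).
* §3 `fullCl_of_isBlowup_of_chart` — FULL-ness of a blowing up `π₂ : Y₂ → Y` along `J` at the points over `ι(T)` from «every blowing up of the chart `U` along `J|_U` is FULL over
  `T`» (`IsBlowup.restrict` to `ι(U)`, transport along `U ≅ ι(U)`, stalks along the open immersion `π₂⁻¹ι(U) ↪ Y₂`); `forall_isBlowup_fullCl_of_affineModel` — that input from an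
  AFFINE MODEL `U ≅ Spec A`, `J|_U = I~`, `affineBlowup I` FULL at every point (uniqueness of blowing ups).
* §4 ★★ `fHalfConclusion_of_twoStoreys_map` — ✓ p665204 `fHalfConclusion_of_twoStoreys_split` with `J′ := K′.map ι` and `π₂` ANY blowing up of `X₁` along it (`exists_isBlowup`):
  inputs (α) every blowing up of `U` along `K′` FULL at every point, (β) FULL of the blowings up of `X₁` along `J′` at the points over `Supp J′ ∖ ι(U)` (the finitely many
  boundary points — to be discharged on the neighbouring charts with §3), (γ) `X₁` FULL over the generizations of `x` off `Supp J′`; and its AFFINE first-storey form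
  `fHalfConclusion_of_twoStoreys_map_affine` (`X = Spec A`, `π₁ = affineBlowup.π (τ * K)`, `V(τ), V(K) ∋ v` only) — the shape of row #8 `f4pos_rowD_twoStorey`.
[cite: GortzWedhorn2020, Prop. 13.91 and (13.19)] [cite: StacksProject, Tag 080B and Tag 01OG] [cite: Temkin2008, Lemma 2.1.4]
-/

-- single-problem summit: the doubled namespace component is forced
set_option linter.dupNamespace false

noncomputable section

namespace Summit.ResolutionOfSingularities.ResolutionOfSingularities.Theorems.FInjectiveMacaulayfication.FHalfRowOfTwoStoreys

open CategoryTheory CategoryTheory.Limits AlgebraicGeometry TopologicalSpace IsLocalRing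
open Literature.AlgebraicGeometry.Resolution
open Summit.ResolutionOfSingularities.ResolutionOfSingularities.Theorems.FInjectiveMacaulayfication
open SliceableCentre GermOfGlobalBlowup

universe u

/-! ## §1 Push-forward of an ideal sheaf along an open immersion restricts back to itself -/

/-- Plumbing: the ideals of an ideal sheaf at two EQUAL affine opens agree through the restriction map along the equality. [plumbing] -/
theorem ideal_comap_presheaf_map_eqToHom {Y : Scheme.{u}} (I : Y.IdealSheafData) {V₁ V₂ : Y.Opens} (h : V₁ = V₂)
    (h₁ : IsAffineOpen V₁) (h₂ : IsAffineOpen V₂) :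
    (I.ideal ⟨V₁, h₁⟩).comap (Y.presheaf.map (eqToHom h).op).hom = I.ideal ⟨V₂, h₂⟩ := by
  subst h
  rw [eqToHom_refl, op_id, Y.presheaf.map_id, CommRingCat.hom_id]
  exact Ideal.comap_id _

/-- **`(K.map ι)|_U = K`** for an open immersion `ι : U → Y` (quasi-compact, e.g. `U` affine and `Y` quasi-separated): the push-forward (largest extension) of an ideal
sheaf along an open immersion restricts back to the ideal sheaf. On an affine open `W ⊆ U`: `((K.map ι).comap ι)(W) = (K.map ι)(ι W) = K(ι⁻¹ ι W) = K(W)` by Mathlib's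
`ideal_comap_of_isOpenImmersion`, `ideal_map`, `appIso_inv_app`. [cite: GortzWedhorn2020, Prop. 13.91 (2)] [folklore] -/
theorem comap_map_of_isOpenImmersion {U Y : Scheme.{u}} (ι : U ⟶ Y) [IsOpenImmersion ι] [QuasiCompact ι] (K : U.IdealSheafData) :
    (K.map ι).comap ι = K := by
  refine Scheme.IdealSheafData.ext (funext fun W => ?_)
  have H : IsAffineOpen (ι ⁻¹ᵁ (ι ''ᵁ (W : U.Opens))) := by
    rw [ι.preimage_image_eq]
    exact W.2
  rw [Scheme.IdealSheafData.ideal_comap_of_isOpenImmersion,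
    Scheme.IdealSheafData.ideal_map K ι ⟨ι ''ᵁ (W : U.Opens), W.2.image_of_isOpenImmersion ι⟩ H, Ideal.comap_comap,
    ← CommRingCat.hom_comp, Scheme.Hom.appIso_inv_app]
  exact ideal_comap_presheaf_map_eqToHom K (ι.preimage_image_eq W) H W.2

/-- The push-forward of a non-zero ideal sheaf along a (quasi-compact) open immersion is non-zero. [folklore] -/
theorem map_ne_bot_of_isOpenImmersion {U Y : Scheme.{u}} (ι : U ⟶ Y) [IsOpenImmersion ι] [QuasiCompact ι] {K : U.IdealSheafData}
    (hK : K ≠ ⊥) : K.map ι ≠ ⊥ := by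
  intro h
  apply hK
  rw [← comap_map_of_isOpenImmersion ι K, h, Scheme.IdealSheafData.comap_bot]

/-! ## §2 The support of the push-forward relative to a point of the base -/

/-- If `ι(Supp K)` lies over the closure of `x` (along `π : Y → X`), so does `Supp (K.map ι) = closure ι(Supp K)`. [folklore; cite: StacksProject, Tag 01R8] -/
theorem specializes_of_mem_support_map {U Y X : Scheme.{u}} (ι : U ⟶ Y) [QuasiCompact ι] (K : U.IdealSheafData) (π : Y ⟶ X) (x : X)
    (hK : ∀ u ∈ (K.support : Set U), x ⤳ π.base (ι.base u)) :
    ∀ y ∈ ((K.map ι).support : Set Y), x ⤳ π.base y := by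
  intro y hy
  have hy' : y ∈ closure ((fun u : U => ι.base u) '' (K.support : Set U)) := by
    have := hy
    rw [Scheme.IdealSheafData.support_map] at this
    exact this
  have hsub : (fun u : U => ι.base u) '' (K.support : Set U) ⊆ (fun y : Y => π.base y) ⁻¹' closure ({x} : Set X) := by
    rintro _ ⟨u, hu, rfl⟩
    exact specializes_iff_mem_closure.mp (hK u hu)
  have hcl : IsClosed ((fun y : Y => π.base y) ⁻¹' closure ({x} : Set X)) := isClosed_closure.preimage π.continuous
  exact specializes_iff_mem_closure.mpr ((closure_minimal hsub hcl) hy')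

/-- Hence `Supp (K.map ι)` meets the generizations of `x` only in `x` — the `hsupp'` input of the two-storey glue. [folklore] -/
theorem support_map_generization {U Y X : Scheme.{u}} (ι : U ⟶ Y) [QuasiCompact ι] (K : U.IdealSheafData) (π : Y ⟶ X) (x : X)
    (hK : ∀ u ∈ (K.support : Set U), x ⤳ π.base (ι.base u)) :
    ∀ y ∈ ((K.map ι).support : Set Y), π.base y ⤳ x → π.base y = x :=
  fun y hy hyx => (hyx.antisymm (specializes_of_mem_support_map ι K π x hK y hy)).eq

/-! ## §3 FULL-ness of a blowing up over a chart, from the blowing ups of the chart -/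

/-- ★ **FULL over a chart.** `ι : U → Y` an open immersion, `π₂ : Y₂ → Y` a blowing up along `J`; if every blowing up of `U` along `J|_U` is FULL at its points over `T ⊆ U`,
then `Y₂` is FULL at every point over `ι(T)`: `π₂` restricted over `ι(U)` is a blowing up of `ι(U) ≅ U` along `J|_U` (Görtz–Wedhorn Prop. 13.91 (2)), and the stalks of
`π₂⁻¹ ι(U) ↪ Y₂` are those of `Y₂`. [cite: GortzWedhorn2020, Prop. 13.91 (2)] -/
theorem fullCl_of_isBlowup_of_chart (p : ℕ) {U Y Y₂ : Scheme.{0}} (ι : U ⟶ Y) [IsOpenImmersion ι] (J : Y.IdealSheafData)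
    {π₂ : Y₂ ⟶ Y} (hπ₂ : IsBlowup π₂ J) (T : Set U)
    (hα : ∀ (W : Scheme.{0}) (ρ : W ⟶ U), IsBlowup ρ (J.comap ι) → ∀ w : W, ρ.base w ∈ T → FullCl p (W.presheaf.stalk w))
    (y₂ : Y₂) (hy : π₂.base y₂ ∈ (fun u : U => ι.base u) '' T) : FullCl p (Y₂.presheaf.stalk y₂) := by
  obtain ⟨u, huT, hu⟩ := hy
  -- restrict `π₂` over `V = ι(U)` and transport along `e : U ≅ V`
  let V : Y.Opens := ι.opensRange
  let e : U ≅ (V : Scheme.{0}) := ι.isoOpensRange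
  have hres : IsBlowup (π₂ ∣_ V) (J.comap V.ι) := hπ₂.restrict V
  have hV : J.comap V.ι = (J.comap ι).comap e.inv := by
    rw [← Scheme.IdealSheafData.comap_comp, Scheme.Hom.isoOpensRange_inv_comp]
  rw [hV] at hres
  have hB : IsBlowup ((π₂ ∣_ V) ≫ e.inv) (((J.comap ι).comap e.inv).comap e.hom) := hres.comp_iso e.symm
  have hback : ((J.comap ι).comap e.inv).comap e.hom = J.comap ι := by
    rw [← Scheme.IdealSheafData.comap_comp, e.hom_inv_id, Scheme.IdealSheafData.comap_id]
  rw [hback] at hB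
  -- the point `y₂` seen in `π₂⁻¹ V`, and its image `u ∈ T`
  have hyV : y₂ ∈ π₂ ⁻¹ᵁ V := by
    show π₂.base y₂ ∈ Set.range ι.base
    exact ⟨u, hu⟩
  have himg : ((π₂ ∣_ V) ≫ e.inv).base ⟨y₂, hyV⟩ = u := by
    have h1 : ((π₂ ∣_ V).base ⟨y₂, hyV⟩).1 = π₂.base y₂ := morphismRestrict_base_coe π₂ V ⟨y₂, hyV⟩
    have h2 : (e.hom.base u).1 = ι.base u := by
      have h := Scheme.Hom.comp_apply e.hom V.ι u
      rw [Scheme.Hom.isoOpensRange_hom_ι] at h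
      rw [h]
      rfl
    have hu' : ι.base u = π₂.base y₂ := hu
    have h3 : (π₂ ∣_ V).base ⟨y₂, hyV⟩ = e.hom.base u := Subtype.ext (by rw [h1, h2, hu'])
    rw [Scheme.Hom.comp_apply, h3, ← Scheme.Hom.comp_apply, e.hom_inv_id]
    rfl
  have hW := hα _ _ hB ⟨y₂, hyV⟩ (by rw [himg]; exact huT)
  exact FTemkinClosedPoints.fullCl_of_isIso_stalkMap p (π₂ ⁻¹ᵁ V).ι ⟨y₂, hyV⟩ hW

/-- ★ **The chart input from an AFFINE MODEL.** `e : U ≅ Spec A` and `affineBlowup I` FULL at every point ⇒ every blowing up of `U` along `e^* I~` is FULL at every point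
(uniqueness of blowing ups up to isomorphism). [cite: GortzWedhorn2020, (13.19)] [folklore transport] -/
theorem forall_isBlowup_fullCl_of_affineModel (p : ℕ) {U : Scheme.{0}} {A : Type} [CommRing A] (I : Ideal A) (e : U ≅ Spec (.of A))
    (hfull : ∀ y : ↥(affineBlowup I), FullCl p ((affineBlowup I).presheaf.stalk y)) :
    ∀ (W : Scheme.{0}) (ρ : W ⟶ U), IsBlowup ρ ((affineBlowup.idealSheaf I).comap e.hom) → ∀ w : W, FullCl p (W.presheaf.stalk w) := by
  intro W ρ hρ w
  have hB : IsBlowup (ρ ≫ e.hom) (((affineBlowup.idealSheaf I).comap e.hom).comap e.inv) := hρ.comp_iso e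
  have hback : ((affineBlowup.idealSheaf I).comap e.hom).comap e.inv = affineBlowup.idealSheaf I := by
    rw [← Scheme.IdealSheafData.comap_comp, e.inv_hom_id, Scheme.IdealSheafData.comap_id]
  rw [hback] at hB
  obtain ⟨f, -, -⟩ := hB.unique (affineBlowup.isBlowup I)
  exact FTemkinClosedPoints.fullCl_of_isIso_stalkMap' p f.hom w (hfull (f.hom.base w))

/-- Corollary of §3 for the push-forward centre: `π₂` a blowing up of `Y` along `K.map ι`, every blowing up of `U` along `K` FULL at every point ⇒ `Y₂` FULL over `ι(U)`.
[cite: GortzWedhorn2020, Prop. 13.91 (2)] -/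
theorem fullCl_of_isBlowup_map_of_mem_range (p : ℕ) {U Y Y₂ : Scheme.{0}} (ι : U ⟶ Y) [IsOpenImmersion ι] [QuasiCompact ι] (K : U.IdealSheafData)
    {π₂ : Y₂ ⟶ Y} (hπ₂ : IsBlowup π₂ (K.map ι))
    (hα : ∀ (W : Scheme.{0}) (ρ : W ⟶ U), IsBlowup ρ K → ∀ w : W, FullCl p (W.presheaf.stalk w))
    (y₂ : Y₂) (hy : π₂.base y₂ ∈ Set.range ι.base) : FullCl p (Y₂.presheaf.stalk y₂) := by
  refine fullCl_of_isBlowup_of_chart p ι (K.map ι) hπ₂ Set.univ (fun W ρ hρ w _ => ?_) y₂ ?_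
  · rw [comap_map_of_isOpenImmersion] at hρ
    exact hα W ρ hρ w
  · obtain ⟨u, hu⟩ := hy
    exact ⟨u, Set.mem_univ u, hu⟩

/-! ## §4 The two-storey glue with a pushed-forward second-storey centre -/

/-- ★★ **TWO-STOREY GLUE, PUSH-FORWARD FORM (W1′).** `X` integral Noetherian, `x ∈ X`; STOREY 1 `π₁ : X₁ → X` a blowing up along `Jτ·JK ≠ ⊥` with supports meeting the
generizations of `x` only in `x`; a chart `ι : U → X₁` (open immersion, quasi-compact) and an ideal sheaf `K′ ≠ ⊥` on `U` whose support lies over the closure of `x`;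
STOREY 2 := ANY blowing up of `X₁` along `J′ := K′.map ι`. INPUTS: (α) every blowing up of `U` along `K′` is FULL at every point; (β) every blowing up of `X₁` along `J′` is
FULL at its points over `Supp J′ ∖ ι(U)`; (γ) `X₁` is FULL at the points over a generization of `x` off `Supp J′`. THEN the F-half's conclusion holds for every blowing
up of `Spec 𝒪_{X,x}` along `Jτ·𝒪_{X,x}`. [cite: StacksProject, Tag 080B and Tag 01OG] [cite: Temkin2008, Lemma 2.1.4] [cite: GortzWedhorn2020, Prop. 13.91] -/
theorem fHalfConclusion_of_twoStoreys_map (p : ℕ) {X X₁ U : Scheme.{0}} [IsIntegral X] [IsNoetherian X] (x : X)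
    {π₁ : X₁ ⟶ X} {Jτ JK : X.IdealSheafData} (hπ₁ : IsBlowup π₁ (Jτ * JK)) (hJ : Jτ * JK ≠ ⊥)
    (hsuppτ : ∀ y ∈ (Jτ.support : Set X), y ⤳ x → y = x) (hsuppK : ∀ y ∈ (JK.support : Set X), y ⤳ x → y = x)
    (ι : U ⟶ X₁) [IsOpenImmersion ι] [QuasiCompact ι] (K' : U.IdealSheafData) (hK' : K' ≠ ⊥)
    (hsuppK' : ∀ u ∈ (K'.support : Set U), x ⤳ π₁.base (ι.base u))
    (hα : ∀ (W : Scheme.{0}) (ρ : W ⟶ U), IsBlowup ρ K' → ∀ w : W, FullCl p (W.presheaf.stalk w))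
    (hβ : ∀ (X₂ : Scheme.{0}) (π₂ : X₂ ⟶ X₁), IsBlowup π₂ (K'.map ι) →
      ∀ x₂ : X₂, π₂.base x₂ ∈ ((K'.map ι).support : Set X₁) → π₂.base x₂ ∉ Set.range ι.base → FullCl p (X₂.presheaf.stalk x₂))
    (hγ : ∀ x₁ : X₁, x₁ ∉ ((K'.map ι).support : Set X₁) → π₁.base x₁ ⤳ x → FullCl p (X₁.presheaf.stalk x₁)) :
    ∀ (S' : Scheme.{0}) (g : S' ⟶ Spec (X.presheaf.stalk x)), IsBlowup g (Jτ.comap (X.fromSpecStalk x)) →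
      ∃ 𝓚 : S'.IdealSheafData, 𝓚 ≠ ⊥ ∧ (∀ s ∈ (𝓚.support : Set S'), g.base s = closedPoint (X.presheaf.stalk x)) ∧
        ∀ (S'' : Scheme.{0}) (π : S'' ⟶ S'), IsBlowup π 𝓚 → ∀ s : S'', FullCl p (S''.presheaf.stalk s) := by
  obtain ⟨X₂, π₂, hπ₂⟩ := exists_isBlowup X₁ (K'.map ι)
  refine fHalfConclusion_of_twoStoreys_split p x hπ₁ hJ hsuppτ hsuppK hπ₂ (map_ne_bot_of_isOpenImmersion ι hK')
    (support_map_generization ι K' π₁ x hsuppK') (fun x₂ hx₂ => ?_) hγ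
  by_cases hr : π₂.base x₂ ∈ Set.range ι.base
  · exact fullCl_of_isBlowup_map_of_mem_range p ι K' hπ₂ hα x₂ hr
  · exact hβ X₂ π₂ hπ₂ x₂ hx₂ hr

/-- ★★ **AFFINE FIRST-STOREY FORM** (the shape of row #8): `A` a Noetherian domain, `τ, K ≠ ⊥` ideals with `V(τ), V(K)` meeting the generizations of `v` only in `v`
(`v ⊆ √τ`, `v ⊆ √K`), `X₁ = affineBlowup (τ * K)`; chart `ι : U → X₁`, `K′ ≠ ⊥` on `U` supported over the closure of `v`; inputs (α) (β) (γ) as in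
`fHalfConclusion_of_twoStoreys_map`. THEN the F-half's conclusion for every blowing up of `Spec 𝒪_{Spec A,v}` along `τ·𝒪`. [cite: StacksProject, Tag 080B] [cite: GortzWedhorn2020, (13.19)] -/
theorem fHalfConclusion_of_twoStoreys_map_affine (p : ℕ) {A : Type} [CommRing A] [IsDomain A] [IsNoetherianRing A] (τ K : Ideal A) (hτ : τ ≠ ⊥) (hK : K ≠ ⊥)
    (v : Spec (.of A)) (hvτ : v.asIdeal ≤ τ.radical) (hvK : v.asIdeal ≤ K.radical)
    {U : Scheme.{0}} (ι : U ⟶ affineBlowup (τ * K)) [IsOpenImmersion ι] [QuasiCompact ι] (K' : U.IdealSheafData) (hK' : K' ≠ ⊥)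
    (hsuppK' : ∀ u ∈ (K'.support : Set U), v ⤳ (affineBlowup.π (τ * K)).base (ι.base u))
    (hα : ∀ (W : Scheme.{0}) (ρ : W ⟶ U), IsBlowup ρ K' → ∀ w : W, FullCl p (W.presheaf.stalk w))
    (hβ : ∀ (X₂ : Scheme.{0}) (π₂ : X₂ ⟶ affineBlowup (τ * K)), IsBlowup π₂ (K'.map ι) →
      ∀ x₂ : X₂, π₂.base x₂ ∈ ((K'.map ι).support : Set ↥(affineBlowup (τ * K))) → π₂.base x₂ ∉ Set.range ι.base → FullCl p (X₂.presheaf.stalk x₂))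
    (hγ : ∀ x₁ : ↥(affineBlowup (τ * K)), x₁ ∉ ((K'.map ι).support : Set ↥(affineBlowup (τ * K))) → (affineBlowup.π (τ * K)).base x₁ ⤳ v →
      FullCl p ((affineBlowup (τ * K)).presheaf.stalk x₁)) :
    ∀ (S' : Scheme.{0}) (g : S' ⟶ Spec ((Spec (.of A)).presheaf.stalk v)),
      IsBlowup g ((affineBlowup.idealSheaf τ).comap ((Spec (.of A)).fromSpecStalk v)) →
      ∃ 𝓚 : S'.IdealSheafData, 𝓚 ≠ ⊥ ∧ (∀ s ∈ (𝓚.support : Set S'), g.base s = closedPoint ((Spec (.of A)).presheaf.stalk v)) ∧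
        ∀ (S'' : Scheme.{0}) (π : S'' ⟶ S'), IsBlowup π 𝓚 → ∀ s : S'', FullCl p (S''.presheaf.stalk s) := by
  have hπ : IsBlowup (affineBlowup.π (τ * K)) (affineBlowup.idealSheaf τ * affineBlowup.idealSheaf K) := by
    rw [← affineBlowup.idealSheaf_mul]
    exact affineBlowup.isBlowup (τ * K)
  have hJ : affineBlowup.idealSheaf τ * affineBlowup.idealSheaf K ≠ ⊥ := by
    rw [← affineBlowup.idealSheaf_mul]
    exact affineBlowup.idealSheaf_ne_bot (mul_ne_zero hτ hK)
  have hsupp : ∀ (L : Ideal A), v.asIdeal ≤ L.radical → ∀ y ∈ ((affineBlowup.idealSheaf L).support : Set (Spec (.of A))), y ⤳ v → y = v := by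
    intro L hvL y hy hyv
    rw [affineBlowup.support_idealSheaf] at hy
    have hLy : L ≤ y.asIdeal := fun a ha => hy ha
    have h1 : v.asIdeal ≤ y.asIdeal := hvL.trans (y.2.radical_le_iff.mpr hLy)
    have h2 : y.asIdeal ≤ v.asIdeal := (PrimeSpectrum.le_iff_specializes y v).mpr hyv
    exact PrimeSpectrum.ext (le_antisymm h2 h1)
  exact fHalfConclusion_of_twoStoreys_map p v hπ hJ (hsupp τ hvτ) (hsupp K hvK) ι K' hK' hsuppK' hα hβ hγ

end Summit.ResolutionOfSingularities.ResolutionOfSingularities.Theorems.FInjectiveMacaulayfication.FHalfRowOfTwoStoreys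

end
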